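import Mathlib.LinearAlgebra.Matrix.Block
import Mathlib.Algebra.Order.Antidiag.FinsuppEquiv
import Mathlib.Logic.Equiv.Fin.Basic
import Literature.Barriers.ValiantsHypothesis.ShiftedPartialsDegenerations
import Literature.Barriers.ValiantsHypothesis.ShiftedPartialsMonotone
import Literature.Computability.AlgebraicComplexity.OrbitClosure
import HarnessLib

/-!
# Shifted partial derivatives: Case C1 of Efremenko–Landsberg–Schenck–Weyman's Theorem 1.5
(large order `k`), by a block-diagonal degeneration of the determinant

Support file for the barrier entry `ShiftedPartialDerivatives.lean` (`ShiftedPartialsCannotSeparate`,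
ELSW Thm. 1.5). Letters as in ELSW: `m` = permanent size, `n` = determinant size, `s = n - k`
derivatives REMAIN after `k` are taken, `P = ℓ^{n-m} perm_m` the padded permanent (tree:
`paddedPerPoly K m n`, `ℓ = x₀₀`, `perm_m` on the bottom-right block), `z` its `m² + 1` variables.

**The printed Case C1** (§3, `k > n - n/(m+1)`, i.e. `(m+1) s < n`): restrict `det_n` to `s`
diagonal `m × m` blocks all equal to `(y^i_j)` and `ℓ` on the rest of the diagonal, `R = ℓ^r det_m(y)^s`;
"Then the space of partials of `R` of degree `n-k` ... contains a space isomorphic to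
`S^{n-k}ℂ^{m²+1}`, and `I^{ℓ^{n-m}perm_m,k}_{n-k} ⊂ S^{n-k}ℂ^{m²+1}` so we conclude." The containment is
asserted without proof (it amounts to the invertibility of a certain element of the group algebra
of `𝔖_b`), and at `k = n - 1` the printed `R` gives EQUALITY of the two ranks, not the strict
inequality claimed. This file proves a VARIANT with a different degeneration and a complete
argument, in the range `(m + 2) s ≤ n` (for `n > 2m² + 2m` this covers `s ≤ 2m - 2`; the printed
range is `(m+1) s < n`; the orders in between are covered by Case C2 in the assembly):

* The degeneration (`blockDegeneration`): `det_n` restricted to `s` diagonal blocks of size `m + 2`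
  followed by `n - (m+2) s` diagonal singles, zero elsewhere (`placement`, `genBlockPoly`,
  `aeval_placement_detPoly`: the restriction is `∏_t det(B_t) · ∏ singles` by the block-determinant
  formula). In each block the TRIDIAGONAL cells and the singles carry distinct private variables
  (`privOf`, rows `1 … n-m-1` of the matrix, away from `z`), and `m² + 2` far-from-diagonal cells carry
  the TARGET variables `z ∪ {w}`, `w = x₀₁`, the same in every block (`targetCell`, `varOfTarget`,
  `tgtOf`, `naming`). It lies in `End(W) · det_n` (`blockDegeneration_mem_endOrbit`).
* Key lemma (`exists_iterPDeriv_blockDegeneration`): every monomial of degree `s` in the target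
  variables is `±` an order-`k` derivative of `R`: for block `t` choose the cell holding the `t`-th
  target and differentiate along the `m + 1` private cells of a tridiagonal matching avoiding it
  (`exists_tridiagonal_matching`, `iterPDeriv_rook_detPoly`), and along all singles; distinct blocks
  have disjoint private variables, so Leibniz gives the product (`iterPDeriv_genList_genBlockPoly`,
  `iterPDeriv_naming_genBlockPoly`).
* Hence the monomials of degree `s + τ` of target-degree `≥ s` lie in the span of the shifted partials
  of `R` (`card_le_shiftedPartialsRank_blockDegeneration`), while the shifted partials of `P` are
  supported on monomials of degree `s + τ` and `z`-degree `≥ s` (`shiftedPartialsRank_paddedPerPoly_le_card`,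
  ELSW's `I^{P,k}_{n-k} ⊂ S^{n-k}ℂ^{m²+1}`); the monomial `w^{s+τ}` is counted once but not twice
  (`card_filter_lt_card_filter`), and `rank R ≤ rank det_n` by `End(W)`-monotonicity
  (`ShiftedPartialsMonotone.lean`). Result: `caseC1`, over every field, for `m ≥ 2`, `n ≥ 2m + 4`,
  `k < n`, `(m+2)(n-k) ≤ n`, all `τ`.

## References

* [EfremenkoLandsbergSchenckWeyman2018] K. Efremenko, J. M. Landsberg, H. Schenck, J. Weyman,
  *The method of shifted partial derivatives cannot separate the permanent from the determinant*,
  Math. Comp. 87 (2018) 2037–2045, §1.3 and §3 (Case C1).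
-/

noncomputable section

namespace Literature.Barriers.ValiantsHypothesis

open MvPolynomial Literature.Computability.AlgebraicComplexity

section Design

variable (K : Type*) [Field K] {c s r n : ℕ}

/-- Generic variables of the block-diagonal shape: the cells of `s` blocks of size `c`, tagged by the
block, and `r` singles (auxiliary construction for Case C1). [cite: EfremenkoLandsbergSchenckWeyman2018, §3 (Case C1, variant)] -/
abbrev GenVar (c s r : ℕ) : Type := ((Fin c × Fin c) × Fin s) ⊕ Fin r

/-- Placement of the generic variables in the `n × n` matrix along `e : Fin n ≃ (Fin c × Fin s) ⊕ Fin r`: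
cell `(a, b)` of block `t` at row `e⁻¹(a,t)`, column `e⁻¹(b,t)`, single `i` at the diagonal position
`e⁻¹ i`, nothing (zero) elsewhere — ELSW's "fill the remainder of the matrix with zeros".
[cite: EfremenkoLandsbergSchenckWeyman2018, §3 (Case C1, variant)] -/
def placement (e : Fin n ≃ (Fin c × Fin s) ⊕ Fin r) (v : Fin n × Fin n) : Option (GenVar c s r) :=
  match e v.1, e v.2 with
  | Sum.inl (a, t), Sum.inl (b, t') => if t = t' then some (Sum.inl ((a, b), t)) else none
  | Sum.inr i, Sum.inr i' => if i = i' then some (Sum.inr i) else none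
  | Sum.inl _, Sum.inr _ => none
  | Sum.inr _, Sum.inl _ => none

/-- The generic block-diagonal determinant: the product of `s` generic `c × c` determinants in disjoint
variables and of `r` single variables. [cite: EfremenkoLandsbergSchenckWeyman2018, §3 (Case C1, variant)] -/
def genBlockPoly (c s r : ℕ) : MvPolynomial (GenVar c s r) K :=
  (∏ t : Fin s, rename (fun ab : Fin c × Fin c => (Sum.inl (ab, t) : GenVar c s r))
      (Literature.Computability.AlgebraicComplexity.detPoly (Fin c) K)) *
    ∏ i : Fin r, X (Sum.inr i)

variable {K}

/-- Restricting `det_n` to the block-diagonal shape gives the generic block polynomial (block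
triangular and block diagonal determinant formulas, Mathlib). [folklore] -/
theorem aeval_placement_detPoly (e : Fin n ≃ (Fin c × Fin s) ⊕ Fin r) :
    aeval (fun v => ((placement e v).elim 0 X : MvPolynomial (GenVar c s r) K))
        (Literature.Computability.AlgebraicComplexity.detPoly (Fin n) K) = genBlockPoly K c s r := by
  classical
  set g : Fin n × Fin n → MvPolynomial (GenVar c s r) K := fun v => (placement e v).elim 0 X
    with hg
  let M' : Matrix ((Fin c × Fin s) ⊕ Fin r) ((Fin c × Fin s) ⊕ Fin r)
      (MvPolynomial (GenVar c s r) K) :=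
    Matrix.fromBlocks
      (Matrix.blockDiagonal fun t : Fin s =>
        (Matrix.mvPolynomialX (Fin c) (Fin c) K).map
          (rename fun ab : Fin c × Fin c => (Sum.inl (ab, t) : GenVar c s r)))
      0 0 (Matrix.diagonal fun i : Fin r => X (Sum.inr i))
  have hM : (aeval g).mapMatrix (Matrix.mvPolynomialX (Fin n) (Fin n) K) = M'.submatrix e e := by
    ext a b
    simp only [AlgHom.mapMatrix_apply, Matrix.map_apply, Matrix.mvPolynomialX_apply, aeval_X,
      Matrix.submatrix_apply, hg, placement]
    rcases ha : e a with ⟨a', t⟩ | i <;> rcases hb : e b with ⟨b', t'⟩ | i'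
    · simp only [M', Matrix.fromBlocks_apply₁₁, Matrix.blockDiagonal_apply', Matrix.map_apply,
        Matrix.mvPolynomialX_apply]
      split_ifs with h
      · subst h; simp
      · simp
    · simp [M']
    · simp [M']
    · simp only [M', Matrix.fromBlocks_apply₂₂, Matrix.diagonal_apply]
      split_ifs with h
      · subst h; simp
      · simp
  rw [Literature.Computability.AlgebraicComplexity.detPoly, AlgHom.map_det, hM,
    Matrix.det_submatrix_equiv_self, Matrix.det_fromBlocks_zero₂₁, Matrix.det_blockDiagonal,
    Matrix.det_diagonal, genBlockPoly]
  congr 1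
  refine Finset.prod_congr rfl fun t _ => ?_
  rw [Literature.Computability.AlgebraicComplexity.detPoly, AlgHom.map_det, AlgHom.mapMatrix_apply]


/-- The generic derivative list: in each block the rook complement of the chosen cell `θ t` w.r.t. the
matching `π t`, then all the singles. [cite: EfremenkoLandsbergSchenckWeyman2018, §3 (Case C1, variant)] -/
def genList (θ : Fin s → Fin c × Fin c) (π : Fin s → Equiv.Perm (Fin c)) : List (GenVar c s r) :=
  (List.finRange s).flatMap (fun t =>
      (((Finset.univ.erase (θ t).2).toList).map (grEmb (π t))).map fun ab => Sum.inl (ab, t)) ++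
    (List.finRange r).map Sum.inr

/-- The generic derivative list has `s (c - 1) + r` entries. [folklore] -/
theorem length_genList (θ : Fin s → Fin c × Fin c) (π : Fin s → Equiv.Perm (Fin c)) :
    (genList (r := r) θ π).length = s * (c - 1) + r := by
  rw [genList, List.length_append, List.length_map, List.length_finRange, List.length_flatMap]
  congr 1
  have : (List.finRange s).map (fun t =>
      ((((Finset.univ.erase (θ t).2).toList).map (grEmb (π t))).map fun ab =>
        (Sum.inl (ab, t) : GenVar c s r)).length) = (List.finRange s).map fun _ => c - 1 := by
    refine List.map_congr_left fun t _ => ?_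
    rw [List.length_map]
    exact length_rook (π t) (θ t).2
  rw [this, List.map_const', List.sum_replicate, List.length_finRange, smul_eq_mul]

/-- Members of the generic derivative list are singles or rook-complement cells. [folklore] -/
theorem mem_genList {θ : Fin s → Fin c × Fin c} {π : Fin s → Equiv.Perm (Fin c)} {x : GenVar c s r}
    (hx : x ∈ genList θ π) :
    (∃ i, x = Sum.inr i) ∨ ∃ t ab, x = Sum.inl (ab, t) ∧ ab.2 ≠ (θ t).2 ∧ ab.1 = π t ab.2 := by
  rw [genList, List.mem_append, List.mem_flatMap, List.mem_map] at hx
  rcases hx with ⟨t, -, ht⟩ | ⟨i, -, rfl⟩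
  · rw [List.mem_map] at ht
    obtain ⟨ab, hab, rfl⟩ := ht
    exact Or.inr ⟨t, ab, rfl, mem_rook.1 hab⟩
  · exact Or.inl ⟨i, rfl⟩

/-- **The generic key computation.** Differentiating the generic block polynomial along the rook
complements of the cells `θ t` (matchings `π t` with `π t (θ t).2 = (θ t).1`) and along all the singles
leaves `(∏ sign π t) ·` the product of the variables of the chosen cells (Leibniz for disjoint
variables + the rook derivative of each `det_c`; cf. ELSW Example 3.1). [cite: EfremenkoLandsbergSchenckWeyman2018, §3 (Example 3.1)] -/
theorem iterPDeriv_genList_genBlockPoly (θ : Fin s → Fin c × Fin c) (π : Fin s → Equiv.Perm (Fin c))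
    (hπ : ∀ t, π t (θ t).2 = (θ t).1) :
    iterPDeriv (genList θ π) (genBlockPoly K c s r) =
      (∏ t, ((Equiv.Perm.sign (π t) : ℤ) : K)) •
        monomial (∑ t, Finsupp.single (Sum.inl (θ t, t) : GenVar c s r) 1) 1 := by
  classical
  set F : Fin s → MvPolynomial (GenVar c s r) K := fun t =>
    rename (fun ab : Fin c × Fin c => (Sum.inl (ab, t) : GenVar c s r))
      (Literature.Computability.AlgebraicComplexity.detPoly (Fin c) K) with hF
  set Λ : Fin s → List (GenVar c s r) := fun t =>
    (((Finset.univ.erase (θ t).2).toList).map (grEmb (π t))).map fun ab => Sum.inl (ab, t) with hΛ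
  have hvarsF : ∀ t, ∀ v ∈ (F t).vars, ∃ ab, v = Sum.inl (ab, t) := by
    intro t v hv
    have := vars_rename _ _ hv
    rw [Finset.mem_image] at this
    obtain ⟨ab, -, rfl⟩ := this
    exact ⟨ab, rfl⟩
  -- Step 1: the singles
  have hPF : genBlockPoly K c s r = ((List.finRange s).map F).prod *
      ((List.finRange r).map fun i => (X (Sum.inr i) : MvPolynomial (GenVar c s r) K)).prod := by
    rw [genBlockPoly, ← Fin.prod_univ_def, ← Fin.prod_univ_def]
  have hsingles : iterPDeriv ((List.finRange r).map Sum.inr)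
      ((List.finRange r).map fun i => (X (Sum.inr i) : MvPolynomial (GenVar c s r) K)).prod = 1 := by
    rw [List.map_eq_flatMap,
      iterPDeriv_list_prod (List.finRange r) (List.nodup_finRange r) _ (fun i => [Sum.inr i])]
    · have : ((List.finRange r).map fun i => iterPDeriv [Sum.inr i]
          (X (Sum.inr i) : MvPolynomial (GenVar c s r) K)) = (List.finRange r).map fun _ => 1 := by
        refine List.map_congr_left fun i _ => ?_
        simp [iterPDeriv]
      rw [this, List.map_const', List.prod_replicate, one_pow]
    · intro i _ j _ hij v hv
      rw [List.mem_singleton] at hv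
      subst hv
      rw [vars_X, Finset.mem_singleton]
      exact fun h => hij (Sum.inr_injective h)
  rw [hPF, genList, iterPDeriv_append, iterPDeriv_mul_left, hsingles, mul_one]
  swap
  · -- singles do not occur in the block factors
    intro v hv hmem
    obtain ⟨i, -, rfl⟩ := List.mem_map.1 hv
    obtain ⟨p, hp, hvp⟩ := exists_mem_vars_of_mem_vars_list_prod _ hmem
    obtain ⟨t, -, rfl⟩ := List.mem_map.1 hp
    obtain ⟨ab, h⟩ := hvarsF t _ hvp
    exact Sum.inr_ne_inl h
  -- Step 2: the blocks
  rw [show (List.finRange s).flatMap (fun t =>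
      (((Finset.univ.erase (θ t).2).toList).map (grEmb (π t))).map fun ab =>
        (Sum.inl (ab, t) : GenVar c s r)) = (List.finRange s).flatMap Λ from rfl,
    iterPDeriv_list_prod (List.finRange s) (List.nodup_finRange s) F Λ]
  swap
  · intro t _ t' _ htt' v hv hv'
    obtain ⟨ab, -, rfl⟩ := List.mem_map.1 hv
    obtain ⟨ab', h⟩ := hvarsF t' _ hv'
    simp only [Sum.inl.injEq, Prod.mk.injEq] at h
    exact htt' h.2
  have hblock : ∀ t, iterPDeriv (Λ t) (F t) =
      ((Equiv.Perm.sign (π t) : ℤ) : K) • X (Sum.inl (θ t, t)) := by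
    intro t
    rw [hΛ, hF]
    simp only
    rw [iterPDeriv_rename (fun ab ab' h => by simpa using h), iterPDeriv_rook_detPoly, map_smul,
      rename_X, hπ]
  rw [show ((List.finRange s).map fun t => iterPDeriv (Λ t) (F t)) =
      (List.finRange s).map fun t => ((Equiv.Perm.sign (π t) : ℤ) : K) •
        (X (Sum.inl (θ t, t)) : MvPolynomial (GenVar c s r) K) from List.map_congr_left fun t _ => hblock t,
    ← Fin.prod_univ_def]
  simp_rw [MvPolynomial.smul_eq_C_mul]
  rw [Finset.prod_mul_distrib, ← map_prod, monomial_sum_one]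
  rfl


/-! ### Naming the generic variables -/

/-- The tridiagonal ("near") cells of a block — these carry private variables. [cite: EfremenkoLandsbergSchenckWeyman2018, §3 (Case C1, variant)] -/
def IsNear (ab : Fin c × Fin c) : Prop :=
  ab.2.val = ab.1.val ∨ ab.2.val = ab.1.val + 1 ∨ ab.1.val = ab.2.val + 1

/-- Nearness is decidable (a disjunction of equalities of naturals). [folklore] -/
instance (ab : Fin c × Fin c) : Decidable (IsNear ab) := by
  unfold IsNear; infer_instance

variable {σ : Type*}

/-- Naming of the generic variables by actual variables: singles and near cells injectively by `priv`
(private variables), the other cells by `tgt` (a target variable, or nothing = zero entry).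
[cite: EfremenkoLandsbergSchenckWeyman2018, §3 (Case C1, variant)] -/
def naming (priv : GenVar c s r → σ) (tgt : Fin c × Fin c → Option σ) : GenVar c s r → Option σ
  | Sum.inr i => some (priv (Sum.inr i))
  | Sum.inl (ab, t) => if IsNear ab then some (priv (Sum.inl (ab, t))) else tgt ab

/-- Entries of the generic derivative list are named privately. [folklore] -/
theorem naming_of_mem_genList (priv : GenVar c s r → σ) (tgt : Fin c × Fin c → Option σ)
    {θ : Fin s → Fin c × Fin c} {π : Fin s → Equiv.Perm (Fin c)}
    (hnear : ∀ t b, b ≠ (θ t).2 → IsNear (π t b, b)) {x : GenVar c s r} (hx : x ∈ genList θ π) :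
    naming priv tgt x = some (priv x) := by
  rcases mem_genList hx with ⟨i, rfl⟩ | ⟨t, ab, rfl, hb, hab⟩
  · rfl
  · have : IsNear ab := by
      have := hnear t ab.2 hb
      rwa [← hab] at this
    simp [naming, this]

/-- A private name has a unique preimage (privates are named injectively and targets are not
private). [folklore] -/
theorem eq_of_naming_eq_some_priv {priv : GenVar c s r → σ} (hpriv : Function.Injective priv)
    {tgt : Fin c × Fin c → Option σ} (htgt : ∀ ab x, tgt ab ≠ some (priv x)) {x y : GenVar c s r}
    (h : naming priv tgt y = some (priv x)) : y = x := by
  rcases y with ⟨ab, t⟩ | i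
  · simp only [naming] at h
    split_ifs at h with hn
    · exact hpriv (Option.some_injective _ h)
    · exact (htgt ab x h).elim
  · exact hpriv (Option.some_injective _ h)

variable [Fintype σ] [DecidableEq σ]

omit [Fintype σ] in
/-- **The key computation, after naming**: along the privately named derivative list, the named block
polynomial differentiates to `±` the product of the target variables sitting in the chosen (far) cells
(chain rule for uniquely named variables + the generic key computation). [cite: EfremenkoLandsbergSchenckWeyman2018, §3 (Case C1, variant)] -/
theorem iterPDeriv_naming_genBlockPoly {priv : GenVar c s r → σ} (hpriv : Function.Injective priv)
    {tgt : Fin c × Fin c → Option σ} (htgt : ∀ ab x, tgt ab ≠ some (priv x))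
    (θ : Fin s → Fin c × Fin c) (π : Fin s → Equiv.Perm (Fin c)) (hπ : ∀ t, π t (θ t).2 = (θ t).1)
    (hnear : ∀ t b, b ≠ (θ t).2 → IsNear (π t b, b)) (hfar : ∀ t, ¬ IsNear (θ t))
    (w : Fin s → σ) (hw : ∀ t, tgt (θ t) = some (w t)) :
    iterPDeriv ((genList θ π).map priv)
        (aeval (fun x => ((naming priv tgt x).elim 0 X : MvPolynomial σ K)) (genBlockPoly K c s r)) =
      (∏ t, ((Equiv.Perm.sign (π t) : ℤ) : K)) • monomial (∑ t, Finsupp.single (w t) 1) 1 := by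
  classical
  rw [iterPDeriv_aeval_option (naming priv tgt) priv (genList θ π)
      (fun x hx => naming_of_mem_genList priv tgt hnear hx)
      (fun x _ y hy => eq_of_naming_eq_some_priv hpriv htgt hy),
    iterPDeriv_genList_genBlockPoly θ π hπ, map_smul]
  congr 1
  rw [monomial_sum_one, monomial_sum_one, map_prod]
  refine Finset.prod_congr rfl fun t _ => ?_
  change aeval _ (X _) = _
  rw [aeval_X]
  simp only [naming, if_neg (hfar t), hw t]
  rfl

/-! ### The concrete design for the padded permanent -/

/-- Target indices: the `m²` block cells of `perm_m`, and two more for `ℓ = x₀₀` and the extra variable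
`w = x₀₁`. [cite: EfremenkoLandsbergSchenckWeyman2018, §3 (Case C1, variant)] -/
abbrev TargetIdx (m : ℕ) : Type := (Fin m × Fin m) ⊕ Fin 2

/-- The cell of a block of size `m + 2` carrying a given target, all at distance `≥ 2` from the
diagonal: upper cells `(p, q + 2)` for `p ≤ q`, lower cells `(p + 1, q)` for `q < p`, and `(m + 1, 0)`,
`(m + 1, 1)` for `ℓ, w`. [cite: EfremenkoLandsbergSchenckWeyman2018, §3 (Case C1, variant)] -/
def targetCell (m : ℕ) : TargetIdx m → Fin (m + 2) × Fin (m + 2)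
  | Sum.inl (p, q) =>
    if q.val < p.val then (⟨p.val + 1, by omega⟩, ⟨q.val, by omega⟩)
    else (⟨p.val, by omega⟩, ⟨q.val + 2, by omega⟩)
  | Sum.inr e => (⟨m + 1, by omega⟩, ⟨e.val, by omega⟩)

/-- Target cells are not tridiagonal (`m ≥ 2` is used for the cell `(m + 1, 1)`). [folklore] -/
theorem not_isNear_targetCell {m : ℕ} (hm : 2 ≤ m) (q : TargetIdx m) : ¬ IsNear (targetCell m q) := by
  rcases q with ⟨p, q⟩ | e
  · simp only [targetCell]
    split_ifs with h <;> simp only [IsNear] <;> omega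
  · have := e.2
    simp only [targetCell, IsNear]
    omega

/-- Distinct targets sit in distinct cells. [folklore] -/
theorem targetCell_injective (m : ℕ) : Function.Injective (targetCell m) := by
  rintro (⟨p, q⟩ | e) (⟨p', q'⟩ | e') h
  · simp only [targetCell] at h
    have := p.2; have := q.2; have := p'.2; have := q'.2
    split_ifs at h with h1 h2 h2 <;> simp only [Prod.mk.injEq, Fin.mk.injEq] at h
    · have hp : p = p' := Fin.ext (by omega)
      have hq : q = q' := Fin.ext (by omega)
      subst hp; subst hq; rfl
    · exfalso; omega
    · exfalso; omega
    · have hp : p = p' := Fin.ext (by omega)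
      have hq : q = q' := Fin.ext (by omega)
      subst hp; subst hq; rfl
  · simp only [targetCell] at h
    have := p.2
    split_ifs at h <;> simp only [Prod.mk.injEq, Fin.mk.injEq] at h <;> omega
  · simp only [targetCell] at h
    have := p'.2
    split_ifs at h <;> simp only [Prod.mk.injEq, Fin.mk.injEq] at h <;> omega
  · simp only [targetCell, Prod.mk.injEq, Fin.mk.injEq, true_and] at h
    exact congrArg Sum.inr (Fin.ext h)

/-- The variable attached to a target: block cell `(p, q) ↦ x_{n-m+p, n-m+q}` (the variables of the
tree's bottom-right `perm_m` block), `ℓ ↦ x₀₀`, `w ↦ x₀₁`. [cite: EfremenkoLandsbergSchenckWeyman2018, §3 (Case C1, variant)] -/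
def varOfTarget (m n : ℕ) (hmn : m ≤ n) (hn : 2 ≤ n) : TargetIdx m → Fin n × Fin n
  | Sum.inl (p, q) => (⟨n - m + p.val, by omega⟩, ⟨n - m + q.val, by omega⟩)
  | Sum.inr e => (⟨0, by omega⟩, ⟨e.val, by omega⟩)

/-- Distinct targets are distinct variables (`m < n`). [folklore] -/
theorem varOfTarget_injective {m n : ℕ} (hmn : m < n) (hn : 2 ≤ n) :
    Function.Injective (varOfTarget m n hmn.le hn) := by
  rintro (⟨p, q⟩ | e) (⟨p', q'⟩ | e') h <;>
    simp only [varOfTarget, Prod.mk.injEq, Fin.mk.injEq] at h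
  · have := p.2; have := q.2
    have hp : p = p' := Fin.ext (by omega)
    have hq : q = q' := Fin.ext (by omega)
    subst hp; subst hq; rfl
  · omega
  · omega
  · exact congrArg Sum.inr (Fin.ext h.2)

/-- A target variable sits in row `0` or in a row `≥ n - m`. [folklore] -/
theorem varOfTarget_fst {m n : ℕ} (hmn : m ≤ n) (hn : 2 ≤ n) (q : TargetIdx m) :
    (varOfTarget m n hmn hn q).1.val = 0 ∨ n - m ≤ (varOfTarget m n hmn hn q).1.val := by
  rcases q with ⟨p, q⟩ | e
  · right; simp [varOfTarget]
  · left; simp [varOfTarget]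

/-- The target variable carried by a cell, if any (partial inverse of `targetCell`, then `varOfTarget`).
[cite: EfremenkoLandsbergSchenckWeyman2018, §3 (Case C1, variant)] -/
def tgtOf (m n : ℕ) (hmn : m ≤ n) (hn : 2 ≤ n) (ab : Fin (m + 2) × Fin (m + 2)) :
    Option (Fin n × Fin n) :=
  if h : ∃ q, targetCell m q = ab then some (varOfTarget m n hmn hn h.choose) else none

/-- The cell of a target carries that target. [folklore] -/
theorem tgtOf_targetCell {m n : ℕ} (hmn : m ≤ n) (hn : 2 ≤ n) (q : TargetIdx m) :
    tgtOf m n hmn hn (targetCell m q) = some (varOfTarget m n hmn hn q) := by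
  have h : ∃ q', targetCell m q' = targetCell m q := ⟨q, rfl⟩
  rw [tgtOf, dif_pos h, targetCell_injective m h.choose_spec]

/-- Private variables: an injection of all generic variables into the cells of rows `1 … n-m-1` of the
matrix (which carry no target), by Euclidean division of an enumeration. [cite: EfremenkoLandsbergSchenckWeyman2018, §3 (Case C1, variant)] -/
def privOf (m n c s r : ℕ) (h : Fintype.card (GenVar c s r) ≤ (n - m - 1) * n) (x : GenVar c s r) :
    Fin n × Fin n :=
  (⟨(Fintype.equivFin (GenVar c s r) x).val / n + 1, by
      have hx := (Fintype.equivFin (GenVar c s r) x).2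
      have h1 : (Fintype.equivFin (GenVar c s r) x).val / n < n - m - 1 :=
        Nat.div_lt_of_lt_mul (by rw [mul_comm]; omega)
      generalize (Fintype.equivFin (GenVar c s r) x).val / n = q at h1 ⊢
      omega⟩,
   ⟨(Fintype.equivFin (GenVar c s r) x).val % n, by
      have hx := (Fintype.equivFin (GenVar c s r) x).2
      apply Nat.mod_lt
      rcases Nat.eq_zero_or_pos n with hn | hn
      · exfalso
        rw [hn, mul_zero] at h
        have := Fintype.card_pos_iff.2 ⟨x⟩
        omega
      · exact hn⟩)

/-- Private variables avoid row `0`. [folklore] -/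
theorem privOf_fst_pos {m n c s r : ℕ} (h : Fintype.card (GenVar c s r) ≤ (n - m - 1) * n)
    (x : GenVar c s r) : 0 < (privOf m n c s r h x).1.val :=
  Nat.succ_pos _

/-- Private variables avoid the rows `≥ n - m`. [folklore] -/
theorem privOf_fst_lt {m n c s r : ℕ} (h : Fintype.card (GenVar c s r) ≤ (n - m - 1) * n)
    (x : GenVar c s r) : (privOf m n c s r h x).1.val < n - m := by
  have hx := (Fintype.equivFin (GenVar c s r) x).2
  have h1 : (Fintype.equivFin (GenVar c s r) x).val / n < n - m - 1 :=
    Nat.div_lt_of_lt_mul (by rw [mul_comm]; omega)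
  change (Fintype.equivFin (GenVar c s r) x).val / n + 1 < n - m
  generalize (Fintype.equivFin (GenVar c s r) x).val / n = q at h1 ⊢
  omega

/-- Private naming is injective. [folklore] -/
theorem privOf_injective {m n c s r : ℕ} (h : Fintype.card (GenVar c s r) ≤ (n - m - 1) * n) :
    Function.Injective (privOf m n c s r h) := by
  intro x y hxy
  simp only [privOf, Prod.mk.injEq, Fin.mk.injEq] at hxy
  obtain ⟨h1, h2⟩ := hxy
  apply (Fintype.equivFin (GenVar c s r)).injective
  apply Fin.ext
  rw [← Nat.div_add_mod (Fintype.equivFin (GenVar c s r) x).val n,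
    ← Nat.div_add_mod (Fintype.equivFin (GenVar c s r) y).val n, h2]
  congr 2
  omega

/-- Target variables are never private variables. [folklore] -/
theorem tgtOf_ne_some_privOf {m n c s r : ℕ} (hmn : m ≤ n) (hn : 2 ≤ n)
    (h : Fintype.card (GenVar c s r) ≤ (n - m - 1) * n) (ab : Fin (m + 2) × Fin (m + 2))
    (x : GenVar c s r) : tgtOf m n hmn hn ab ≠ some (privOf m n c s r h x) := by
  intro heq
  rw [tgtOf] at heq
  split_ifs at heq with hq
  have heq' := Option.some_injective _ heq
  have h1 := privOf_fst_pos h x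
  have h2 := privOf_fst_lt h x
  rw [← heq'] at h1 h2
  rcases varOfTarget_fst hmn hn hq.choose with h0 | h0 <;> omega


/-! ### The degeneration of the determinant and the rank comparison -/

/-- The index equivalence `Fin n ≃ (Fin c × Fin s) ⊕ Fin (n - c s)` placing `s` diagonal blocks of size
`c` first and the singles after them (Mathlib's `finSumFinEquiv`, `finProdFinEquiv`). [folklore] -/
def blockEquiv (c s n : ℕ) (h : c * s ≤ n) : Fin n ≃ (Fin c × Fin s) ⊕ Fin (n - c * s) :=
  (finCongr (by omega : n = c * s + (n - c * s))).trans
    (finSumFinEquiv.symm.trans (Equiv.sumCongr finProdFinEquiv.symm (Equiv.refl _)))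

variable (K)

/-- **The degeneration `R ∈ End(W) · det_n` of Case C1 (variant)**: `det_n` restricted to `s` diagonal
blocks of size `m + 2` — tridiagonal cells: distinct private variables; `m² + 2` far cells: the target
variables `z ∪ {w}`, the same in every block; other cells zero — followed by `n - (m+2)s` private
diagonal singles. (ELSW use `s` blocks `(y^i_j)` of size `m` and `ℓ` on the rest of the diagonal.)
[cite: EfremenkoLandsbergSchenckWeyman2018, §3 (Case C1, variant)] -/
def blockDegeneration (m n s : ℕ) (hmn : m ≤ n) (hn : 2 ≤ n)
    (hcard : Fintype.card (GenVar (m + 2) s (n - (m + 2) * s)) ≤ (n - m - 1) * n) :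
    MvPolynomial (Fin n × Fin n) K :=
  aeval (fun x => ((naming (privOf m n (m + 2) s (n - (m + 2) * s) hcard) (tgtOf m n hmn hn) x).elim
      0 X : MvPolynomial (Fin n × Fin n) K))
    (genBlockPoly K (m + 2) s (n - (m + 2) * s))

variable {K}

/-- The degeneration lies in `End(W) · det_n` (it is `det_n` after a substitution of the entries by
variables or zero). [cite: EfremenkoLandsbergSchenckWeyman2018, §3] -/
theorem blockDegeneration_mem_endOrbit {m n s : ℕ} (hmn : m ≤ n) (hn : 2 ≤ n)
    (hcard : Fintype.card (GenVar (m + 2) s (n - (m + 2) * s)) ≤ (n - m - 1) * n)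
    (hs : (m + 2) * s ≤ n) :
    blockDegeneration K m n s hmn hn hcard ∈
      endOrbit (Fin n × Fin n) K (Literature.Computability.AlgebraicComplexity.detPoly (Fin n) K) := by
  rw [blockDegeneration, ← aeval_placement_detPoly (blockEquiv (m + 2) s n hs),
    aeval_option_aeval_option]
  exact aeval_option_mem_endOrbit _ _

/-- **Key lemma**: every product of `s` target variables is, up to a sign, an order
`s (m+1) + (n - (m+2) s) = n - s` partial derivative of the degeneration — so the order-`k` partials of
`R` contain all of `S^{s}` of the `m² + 2` target variables (ELSW's "contains a space isomorphic to
`S^{n-k}ℂ^{m²+1}`", here with one more variable). [cite: EfremenkoLandsbergSchenckWeyman2018, §3 (Case C1, variant)] -/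
theorem exists_iterPDeriv_blockDegeneration {m n s : ℕ} (hm : 2 ≤ m) (hmn : m ≤ n) (hn : 2 ≤ n)
    (hcard : Fintype.card (GenVar (m + 2) s (n - (m + 2) * s)) ≤ (n - m - 1) * n)
    (qv : Fin s → TargetIdx m) :
    ∃ l : List (Fin n × Fin n), l.length = s * (m + 1) + (n - (m + 2) * s) ∧ ∃ ε : K, ε ≠ 0 ∧
      iterPDeriv l (blockDegeneration K m n s hmn hn hcard) =
        ε • monomial (∑ t, Finsupp.single (varOfTarget m n hmn hn (qv t)) 1) 1 := by
  classical
  let θ : Fin s → Fin (m + 2) × Fin (m + 2) := fun t => targetCell m (qv t)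
  have hπex := fun t => exists_tridiagonal_matching (θ t).1 (θ t).2
  choose π hπ1 hπ2 using hπex
  refine ⟨(genList θ π).map (privOf m n (m + 2) s (n - (m + 2) * s) hcard), ?_,
    ∏ t, ((Equiv.Perm.sign (π t) : ℤ) : K), ?_, ?_⟩
  · rw [List.length_map, length_genList]
    have : m + 2 - 1 = m + 1 := rfl
    rw [this]
  · rw [Finset.prod_ne_zero_iff]
    intro t _
    rcases Int.units_eq_one_or (Equiv.Perm.sign (π t)) with h | h <;> simp [h]
  · exact iterPDeriv_naming_genBlockPoly (privOf_injective hcard)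
      (tgtOf_ne_some_privOf hmn hn hcard) θ π hπ1 (fun t b hb => hπ2 t b hb)
      (fun t => not_isNear_targetCell hm (qv t)) _ (fun t => tgtOf_targetCell hmn hn (qv t))

/-- **Lower bound for the degeneration**: the monomials of degree `s + τ` and target-degree `≥ s`
lie in the span of the order-`(n-s)` shifted partials of `R` of shift `τ`, so their number bounds the
rank from below. [cite: EfremenkoLandsbergSchenckWeyman2018, §3 (Case C1, variant)] -/
theorem card_le_shiftedPartialsRank_blockDegeneration {m n s : ℕ} (hm : 2 ≤ m) (hmn : m ≤ n)
    (hn : 2 ≤ n) (hcard : Fintype.card (GenVar (m + 2) s (n - (m + 2) * s)) ≤ (n - m - 1) * n)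
    (τ : ℕ) :
    (((Finset.univ : Finset (Fin n × Fin n)).finsuppAntidiag (s + τ)).filter fun μ =>
        s ≤ ∑ v ∈ Finset.univ.image (varOfTarget m n hmn hn), μ v).card ≤
      shiftedPartialsRank K (s * (m + 1) + (n - (m + 2) * s)) τ
        (blockDegeneration K m n s hmn hn hcard) := by
  classical
  set R := blockDegeneration K m n s hmn hn hcard with hR
  set Z' : Finset (Fin n × Fin n) := Finset.univ.image (varOfTarget m n hmn hn) with hZ'
  set T' := ((Finset.univ : Finset (Fin n × Fin n)).finsuppAntidiag (s + τ)).filter fun μ =>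
    s ≤ ∑ v ∈ Z', μ v with hT'
  haveI := finite_span_shiftedPartials (K := K) (s * (m + 1) + (n - (m + 2) * s)) τ R
  rw [← finrank_restrictSupport (K := K) T']
  apply Submodule.finrank_mono
  rw [restrictSupport_eq_span, Submodule.span_le]
  rintro _ ⟨μ, hμT, rfl⟩
  rw [Finset.mem_coe, hT', Finset.mem_filter] at hμT
  obtain ⟨hdeg, hsum⟩ := hμT
  rw [← degree_eq_iff_mem_finsuppAntidiag] at hdeg
  obtain ⟨q, hqZ, hγle⟩ := exists_fun_sum_single_le Z' s μ hsum
  have hpre : ∀ t, ∃ idx, varOfTarget m n hmn hn idx = q t := fun t => by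
    have := hqZ t
    rw [hZ', Finset.mem_image] at this
    obtain ⟨idx, -, hidx⟩ := this
    exact ⟨idx, hidx⟩
  choose qv hqv using hpre
  obtain ⟨l, hl, ε, hε, hiter⟩ := exists_iterPDeriv_blockDegeneration (K := K) hm hmn hn hcard qv
  set γ : (Fin n × Fin n) →₀ ℕ := ∑ t, Finsupp.single (q t) 1 with hγ
  have hγ' : (∑ t, Finsupp.single (varOfTarget m n hmn hn (qv t)) 1) = γ := by
    rw [hγ]
    exact Finset.sum_congr rfl fun t _ => by rw [hqv t]
  rw [hγ'] at hiter
  have hmono : monomial μ (1 : K) = ε⁻¹ • (monomial (μ - γ) (1 : K) * iterPDeriv l R) := by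
    rw [hiter, mul_smul_comm, smul_smul, inv_mul_cancel₀ hε, one_smul, monomial_mul, one_mul,
      tsub_add_cancel_of_le hγle]
  show monomial μ (1 : K) ∈ _
  rw [hmono]
  refine Submodule.smul_mem _ _ (Submodule.subset_span ⟨l, μ - γ, hl, ?_, rfl⟩)
  have h1 : (μ - γ).degree + γ.degree = μ.degree := by
    rw [← map_add, tsub_add_cancel_of_le hγle]
  have h2 : γ.degree = s := by
    rw [hγ, map_sum]
    simp
  omega

/-- The padded permanent involves only `x₀₀` and the bottom-right block (its `m² + 1` variables `z`).
[folklore] -/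
theorem vars_paddedPerPoly_subset {m n : ℕ} [NeZero n] :
    (paddedPerPoly K m n).vars ⊆ Finset.univ.filter fun v : Fin n × Fin n =>
      v = (0, 0) ∨ (n - m ≤ v.1.val ∧ n - m ≤ v.2.val) := by
  classical
  rw [paddedPerPoly]
  refine (vars_mul _ _).trans (Finset.union_subset ?_ ?_)
  · intro v hv
    have := vars_pow _ _ hv
    rw [vars_X, Finset.mem_singleton] at this
    subst this
    simp
  · intro v hv
    have := vars_rename _ _ hv
    rw [Finset.mem_image] at this
    obtain ⟨⟨i, j⟩, -, rfl⟩ := this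
    simp only [Finset.mem_filter, Finset.mem_univ, true_and]
    exact Or.inr ⟨i.2, j.2⟩

/-- **Upper bound for the padded permanent**: its order-`k` shifted partials of shift `τ` are supported
on the monomials of degree `n - k + τ` and `z`-degree `≥ n - k`, so their number bounds the rank —
ELSW: "`I^{ℓ^{n-m}perm_m,k}_{n-k} ⊂ S^{n-k}ℂ^{m²+1}`". [cite: EfremenkoLandsbergSchenckWeyman2018, §3] -/
theorem shiftedPartialsRank_paddedPerPoly_le_card {m n : ℕ} (hmn : m ≤ n) [NeZero n] (k τ : ℕ) :
    shiftedPartialsRank K k τ (paddedPerPoly K m n) ≤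
      (((Finset.univ : Finset (Fin n × Fin n)).finsuppAntidiag (n - k + τ)).filter fun μ =>
        n - k ≤ ∑ v ∈ Finset.univ.filter (fun v : Fin n × Fin n =>
          v = (0, 0) ∨ (n - m ≤ v.1.val ∧ n - m ≤ v.2.val)), μ v).card := by
  classical
  set Z : Finset (Fin n × Fin n) := Finset.univ.filter fun v : Fin n × Fin n =>
    v = (0, 0) ∨ (n - m ≤ v.1.val ∧ n - m ≤ v.2.val) with hZ
  set T := ((Finset.univ : Finset (Fin n × Fin n)).finsuppAntidiag (n - k + τ)).filter fun μ =>
    n - k ≤ ∑ v ∈ Z, μ v with hT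
  haveI := finite_restrictSupport (K := K) T
  rw [← finrank_restrictSupport (K := K) T]
  unfold shiftedPartialsRank
  apply Submodule.finrank_mono
  rw [Submodule.span_le]
  rintro _ ⟨l, β, hl, hβ, rfl⟩
  rw [SetLike.mem_coe, mem_restrictSupport_iff]
  intro μ hμ
  have hP : (paddedPerPoly K m n).IsHomogeneous n := paddedPerPoly_isHomogeneous hmn
  have hw : (iterPDeriv l (paddedPerPoly K m n)).IsHomogeneous (n - k) :=
    hl ▸ isHomogeneous_iterPDeriv hP l
  have hvars : (iterPDeriv l (paddedPerPoly K m n)).vars ⊆ Z :=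
    (vars_iterPDeriv_subset l _).trans vars_paddedPerPoly_subset
  obtain ⟨hdeg, hsum⟩ := support_monomial_mul_subset Z hw hvars β (Finset.mem_coe.1 hμ)
  rw [Finset.mem_coe, hT, Finset.mem_filter, ← degree_eq_iff_mem_finsuppAntidiag]
  refine ⟨?_, hsum⟩
  rw [hdeg, hβ]; omega

/-- **Strictness**: `z ⊂ z ∪ {w}`, and the monomial `w^d` has target-degree `d ≥ s` but `z`-degree
`0 < s`, so the permanent-side count is strictly smaller (this is where the printed argument is
incomplete at `k = n - 1`). [cite: EfremenkoLandsbergSchenckWeyman2018, §3 (Case C1, variant)] -/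
theorem card_filter_lt_card_filter {m n : ℕ} (hmn : m < n) (hn : 2 ≤ n) [NeZero n] {s d : ℕ}
    (hs : 0 < s) (hsd : s ≤ d) :
    (((Finset.univ : Finset (Fin n × Fin n)).finsuppAntidiag d).filter fun μ =>
        s ≤ ∑ v ∈ Finset.univ.filter (fun v : Fin n × Fin n =>
          v = (0, 0) ∨ (n - m ≤ v.1.val ∧ n - m ≤ v.2.val)), μ v).card <
      (((Finset.univ : Finset (Fin n × Fin n)).finsuppAntidiag d).filter fun μ =>
        s ≤ ∑ v ∈ Finset.univ.image (varOfTarget m n hmn.le hn), μ v).card := by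
  classical
  set Z : Finset (Fin n × Fin n) := Finset.univ.filter fun v : Fin n × Fin n =>
    v = (0, 0) ∨ (n - m ≤ v.1.val ∧ n - m ≤ v.2.val) with hZ
  set Z' : Finset (Fin n × Fin n) := Finset.univ.image (varOfTarget m n hmn.le hn) with hZ'
  have hZZ' : Z ⊆ Z' := by
    intro v hv
    rw [hZ, Finset.mem_filter] at hv
    rw [hZ', Finset.mem_image]
    rcases hv.2 with rfl | ⟨h1, h2⟩
    · exact ⟨Sum.inr 0, Finset.mem_univ _, Prod.ext (Fin.ext (by simp [varOfTarget]))
        (Fin.ext (by simp [varOfTarget]))⟩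
    · have := v.1.2; have := v.2.2
      refine ⟨Sum.inl (⟨v.1.val - (n - m), by omega⟩, ⟨v.2.val - (n - m), by omega⟩),
        Finset.mem_univ _, Prod.ext (Fin.ext ?_) (Fin.ext ?_)⟩ <;>
        simp only [varOfTarget] <;> omega
  apply Finset.card_lt_card
  rw [Finset.ssubset_iff_of_subset]
  · -- the witness `x₀₁ ^ d`
    set w : Fin n × Fin n := varOfTarget m n hmn.le hn (Sum.inr 1) with hw
    refine ⟨Finsupp.single w d, ?_, ?_⟩
    · rw [Finset.mem_filter, ← degree_eq_iff_mem_finsuppAntidiag, Finsupp.degree_single]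
      refine ⟨rfl, hsd.trans ?_⟩
      have hwZ' : w ∈ Z' := by rw [hZ', Finset.mem_image]; exact ⟨_, Finset.mem_univ _, rfl⟩
      have := Finset.single_le_sum (f := fun v => (Finsupp.single w d : (Fin n × Fin n) →₀ ℕ) v)
        (fun _ _ => Nat.zero_le _) hwZ'
      simpa using this
    · rw [Finset.mem_filter, not_and]
      intro _
      have : ∑ v ∈ Z, (Finsupp.single w d : (Fin n × Fin n) →₀ ℕ) v = 0 := by
        refine Finset.sum_eq_zero fun v hv => ?_
        rw [Finsupp.single_apply, if_neg]
        rintro rfl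
        rw [hZ, Finset.mem_filter] at hv
        rcases hv.2 with h | ⟨h1, -⟩
        · have := congrArg (fun v : Fin n × Fin n => v.2.val) h
          simp [hw, varOfTarget] at this
        · simp [hw, varOfTarget] at h1
          omega
      rw [this]
      omega
  · intro μ
    simp only [Finset.mem_filter]
    rintro ⟨h1, h2⟩
    exact ⟨h1, h2.trans (Finset.sum_le_sum_of_subset hZZ')⟩

/-- **Case C1 of ELSW Thm. 1.5 (variant, proved)**: over every field, for `m ≥ 2`, `n ≥ 2m + 4`, every
order `k < n` with `(m + 2)(n - k) ≤ n` and every shift `τ`,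
`rank((ℓ^{n-m}perm_m)_{(k,n-k)[τ]}) < rank((det_n)_{(k,n-k)[τ]})`:
`rank P ≤ #{z-degree ≥ s} < #{(z ∪ w)-degree ≥ s} ≤ rank R ≤ rank det_n`. The printed Case C1 has the
range `(m+1)(n-k) < n` and an unproved containment; see the module docstring.
[cite: EfremenkoLandsbergSchenckWeyman2018, Thm. 1.5, §1.3 (C1) and §3] -/
theorem caseC1 {m n : ℕ} (hm : 2 ≤ m) (hmn : 2 * m + 4 ≤ n) [NeZero n] (k τ : ℕ) (hk : k < n)
    (hks : (m + 2) * (n - k) ≤ n) :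
    shiftedPartialsRank K k τ (paddedPerPoly K m n) <
      shiftedPartialsRank K k τ (Literature.Computability.AlgebraicComplexity.detPoly (Fin n) K) := by
  set s := n - k with hs
  have hmul : (m + 2) * s = s * (m + 1) + s := by ring
  have hk' : k = s * (m + 1) + (n - (m + 2) * s) := by omega
  have hcard : Fintype.card (GenVar (m + 2) s (n - (m + 2) * s)) ≤ (n - m - 1) * n := by
    simp only [Fintype.card_sum, Fintype.card_prod, Fintype.card_fin]
    calc (m + 2) * (m + 2) * s + (n - (m + 2) * s)
        ≤ (m + 2) * n + n := by
          rw [mul_assoc]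
          exact Nat.add_le_add (Nat.mul_le_mul_left _ hks) (Nat.sub_le _ _)
      _ = (m + 3) * n := by ring
      _ ≤ (n - m - 1) * n := Nat.mul_le_mul_right _ (by omega)
  have h1 := shiftedPartialsRank_paddedPerPoly_le_card (K := K) (m := m) (n := n) (by omega) k τ
  have h2 := card_filter_lt_card_filter (m := m) (n := n) (by omega) (by omega) (s := n - k)
    (d := n - k + τ) (by omega) (by omega)
  have h3 := card_le_shiftedPartialsRank_blockDegeneration (K := K) hm (by omega : m ≤ n)
    (by omega : 2 ≤ n) hcard τ
  have h4 := shiftedPartialsRank_le_of_mem_endOrbit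
    (blockDegeneration_mem_endOrbit (K := K) (by omega : m ≤ n) (by omega : 2 ≤ n) hcard hks) k τ
  rw [← hs] at h1
  rw [← hk'] at h3
  calc shiftedPartialsRank K k τ (paddedPerPoly K m n) ≤ _ := h1
    _ < _ := h2
    _ ≤ _ := h3
    _ ≤ _ := h4

end Design

end Literature.Barriers.ValiantsHypothesis
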